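import Summits.RiemannHypothesis.RiemannHypothesis.Theorems.SoloInformedKunnethDiagonal

/-!
# The squeeze lives on the diagonal, II: finite total off-line excess for `ζ` (solo-informed, T55b)

Specialisation of `SoloInformedKunnethDiagonal` (T55a) to the non-trivial zeros of `ζ`.
`OfflineExcessLe C` := every finite set `S` of non-trivial zeros has `∑_{ρ ∈ S} (Re ρ - 1/2) ≤ C`;
`DistinctKunnethLevel k C` := T54's Künneth level `k` restricted to pairwise-distinct tuples.

* `distinctKunnethTower_iff_offlineExcessLe`: the off-diagonal tower with constant `C` IS finite
  total excess `C`; `exists_distinctKunnethTower_iff` — contrast T54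
  `riemannHypothesis_iff_exists_kunnethTower` (SOME uniform FULL barrier ⟺ RH).
* Worth of finite excess for `ζ`: complex conjugation gives every non-trivial zero a DIFFERENT
  partner with the same real part (`im ρ ≠ 0`), so `OfflineExcessLe C` yields exactly T54's rung
  `k = 2` (`OfflineExcessLe.kunnethLevel_two`; indeed `distinctKunnethLevel_two_iff :
  DistinctKunnethLevel 2 C ↔ KunnethLevel 2 C`), i.e. the tree's `QuasiRiemannHypothesis (1/2 + C/2)`,
  plus finiteness of the zeros right of every `σ > 1/2` with the count `≤ C/(σ - 1/2)` — beyond every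
  density theorem (census F2) — and still not RH (T55a `exists_distinctTower_not_kunnethTower`:
  the two towers separate from `k = 3` on).
* `riemannHypothesis_iff_offlineExcessLe_zero`, `riemannHypothesis_iff_distinctKunnethTower_zero`:
  with the constant `0` everything collapses to level `1`.

Reading (deliverable `sharpest.md` §2g (vi)–(vii)).  The engine that proof shape (2) asks for is
therefore not "an Euler product for pairs / `k`-tuples of zeros" in general — its off-diagonal part
would give the (huge, open) finite-excess theorem and stop there — but the DIAGONAL: symmetric powers
`Sym^k H¹` of ONE arithmetic cohomology of `Spec ℤ` over the absolute point, each with an Euler bound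
whose loss is uniform in `k`.  That is the exact shape of "`Sym^k` functorial for all `k` ⟹
Ramanujan" (Langlands; Serre's observation for `τ(p)`), the same Archimedean squeeze applied to the
local parameters `α_p` — which is RH-blind (census F20: it moves `α_p`, never `ρ`); nothing in print
attaches an Euler product to a tensor power of the zeros themselves (`sharpest.md` §2g (ii′);
searches listed there).  Honest grade: elementary; the value is the precise typing.
-/
noncomputable section

open Complex Set Finset Literature.NumberTheory.LFunctions
open Literature.NumberTheory.LFunctions.ZetaZeros
open scoped ComplexConjugate

namespace Summit.RiemannHypothesis.RiemannHypothesis.Theorems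

variable {k : ℕ} {C σ : ℝ} {ρ : ℂ}

/-! ## The non-trivial zeros of `ζ` -/

/-- Off-diagonal Künneth level `k` with barrier `C` for the non-trivial zeros of `ζ`. [folklore] -/
def DistinctKunnethLevel (k : ℕ) (C : ℝ) : Prop :=
  DistinctKunnethLevelOn riemannZetaNontrivialZeros k C

/-- Total off-line excess of `ζ` at most `C`: `∑_{ρ ∈ S} (Re ρ - 1/2) ≤ C` for every finite set `S`
of non-trivial zeros. [folklore] -/
def OfflineExcessLe (C : ℝ) : Prop :=
  ExcessLeOn riemannZetaNontrivialZeros C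

/-- Full level ⟹ off-diagonal level. [folklore] -/
theorem KunnethLevel.distinct (h : KunnethLevel k C) : DistinctKunnethLevel k C :=
  KunnethLevelOn.distinct (kunnethLevel_iff_kunnethLevelOn.1 h)

/-- **The off-diagonal tower for `ζ` is the total off-line excess.** [folklore] -/
theorem distinctKunnethTower_iff_offlineExcessLe :
    (∀ k : ℕ, DistinctKunnethLevel k C) ↔ OfflineExcessLe C :=
  distinctKunnethTowerOn_iff_excessLeOn

/-- The existential forms agree: SOME uniform off-diagonal barrier ⟺ finite total excess — to be
contrasted with T54 `riemannHypothesis_iff_exists_kunnethTower` (SOME uniform full barrier ⟺ RH).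
[folklore] -/
theorem exists_distinctKunnethTower_iff :
    (∃ C : ℝ, ∀ k : ℕ, DistinctKunnethLevel k C) ↔ ∃ C : ℝ, OfflineExcessLe C :=
  exists_congr fun _ ↦ distinctKunnethTower_iff_offlineExcessLe

/-- Finite excess `C` puts every non-trivial zero in `Re ρ ≤ 1/2 + C/2`: `conj ρ` is a DIFFERENT
non-trivial zero (`im ρ ≠ 0`) with the same real part, so the pair `{ρ, conj ρ}` realises the
diagonal real part at `k = 2`. [folklore] -/
theorem OfflineExcessLe.re_le (h : OfflineExcessLe C) (hρ : ρ ∈ riemannZetaNontrivialZeros) :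
    ρ.re ≤ 1 / 2 + C / 2 :=
  ExcessLeOn.re_le_of_pair h hρ (riemannZetaNontrivialZeros.conj_mem hρ)
    (fun he ↦ riemannZetaNontrivialZeros.im_ne_zero hρ (Complex.conj_eq_iff_im.1 he.symm))
    (Complex.conj_re ρ)

/-- **Finite excess `C` IS WORTH EXACTLY RUNG 2**: it gives T54's level `2` with the same barrier
(`ζ(s) ≠ 0` for `Re s > 1/2 + C/2`). [folklore] -/
theorem OfflineExcessLe.kunnethLevel_two (h : OfflineExcessLe C) : KunnethLevel 2 C :=
  (kunnethLevel_iff (by norm_num)).2 fun _ hρ ↦ by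
    have h1 := h.re_le hρ
    push_cast
    linarith

/-- For `ζ` the off-diagonal SQUARE is already the full square (conjugate pairs supply the
diagonal); the separation of the two towers happens from `k = 3` on and in the limit. [folklore] -/
theorem distinctKunnethLevel_two_iff : DistinctKunnethLevel 2 C ↔ KunnethLevel 2 C := by
  refine ⟨fun h ↦ (kunnethLevel_iff (by norm_num)).2 fun ρ hρ ↦ ?_, KunnethLevel.distinct⟩
  have hne : ρ ≠ conj ρ := fun he ↦
    riemannZetaNontrivialZeros.im_ne_zero hρ (Complex.conj_eq_iff_im.1 he.symm)
  have hS : (↑({ρ, conj ρ} : Finset ℂ) : Set ℂ) ⊆ riemannZetaNontrivialZeros := by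
    intro z hz
    simp only [Finset.coe_insert, Finset.coe_singleton, Set.mem_insert_iff,
      Set.mem_singleton_iff] at hz
    rcases hz with rfl | rfl
    · exact hρ
    · exact riemannZetaNontrivialZeros.conj_mem hρ
  have h1 := (distinctKunnethLevelOn_iff.1 h) {ρ, conj ρ} hS (Finset.card_pair hne)
  rw [Finset.sum_pair hne, Complex.conj_re] at h1
  push_cast at h1 ⊢
  linarith

/-- Finite excess `C ≥ 0`... gives the tree's quasi-Riemann hypothesis at `1/2 + C/2`. [folklore] -/
theorem OfflineExcessLe.quasiRiemannHypothesis (h : OfflineExcessLe C) :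
    QuasiRiemannHypothesis (1 / 2 + C / 2) := by
  have h1 := quasiRiemannHypothesis_of_kunnethLevel (k := 2) (C := C) (by norm_num)
    (ExcessLeOn.nonneg h) h.kunnethLevel_two
  norm_num at h1 ⊢
  exact h1

/-- Finite excess ⟹ for every `σ > 1/2` only finitely many non-trivial zeros have `Re ρ ≥ σ`,
at most `C/(σ - 1/2)` of them (counted without multiplicity). [folklore] -/
theorem OfflineExcessLe.finite_re_ge (h : OfflineExcessLe C) (hσ : 1 / 2 < σ) :
    (riemannZetaNontrivialZeros ∩ {z | σ ≤ z.re}).Finite ∧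
      ((riemannZetaNontrivialZeros ∩ {z | σ ≤ z.re}).ncard : ℝ) ≤ C / (σ - 1 / 2) :=
  ⟨ExcessLeOn.finite_re_ge h hσ, ExcessLeOn.ncard_re_ge_le h hσ⟩

/-- RH gives excess `0`. [folklore] -/
theorem offlineExcessLe_of_riemannHypothesis (hRH : RiemannHypothesis) : OfflineExcessLe 0 := by
  intro S hS
  refine Finset.sum_nonpos fun ρ hρ ↦ ?_
  have h1 := (kunnethLevel_iff le_rfl).1 (kunnethLevel_of_riemannHypothesis hRH 1) ρ
    (hS (Finset.mem_coe.2 hρ))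
  norm_num at h1
  linarith

/-- Excess `0` gives RH (singletons give `Re ρ ≤ 1/2`; then the symmetry `ρ ↦ 1 - conj ρ`, via T54's
squeeze with the constant tower). [folklore] -/
theorem riemannHypothesis_of_offlineExcessLe_zero (h : OfflineExcessLe 0) : RiemannHypothesis :=
  riemannHypothesis_of_kunnethTower (C := 0) fun _ hk ↦
    (kunnethLevel_iff hk).2 fun _ hρ ↦ by
      have h1 := ExcessLeOn.re_le h hρ
      norm_num at h1 ⊢
      exact h1

/-- **`RiemannHypothesis ↔` total off-line excess `0`.** [folklore] -/
theorem riemannHypothesis_iff_offlineExcessLe_zero : RiemannHypothesis ↔ OfflineExcessLe 0 :=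
  ⟨offlineExcessLe_of_riemannHypothesis, riemannHypothesis_of_offlineExcessLe_zero⟩

/-- **`RiemannHypothesis ↔` the off-diagonal tower with barrier `0`** — with the constant `0` the
two towers agree (level `1` alone is RH); with a positive constant they differ by exactly
"finite excess versus zero excess" (`exists_distinctKunnethTower_iff`,
`exists_distinctTower_not_kunnethTower`). [folklore] -/
theorem riemannHypothesis_iff_distinctKunnethTower_zero :
    RiemannHypothesis ↔ ∀ k : ℕ, DistinctKunnethLevel k 0 := by
  rw [distinctKunnethTower_iff_offlineExcessLe]
  exact riemannHypothesis_iff_offlineExcessLe_zero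

end Summit.RiemannHypothesis.RiemannHypothesis.Theorems

end
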